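/-
Public-domain reproduction (cell pub-lg7, seat 5).  A certificate FORMAT for the truncated singular-series mean of
Heath-Brown–Puchta §4 (22) and its soundness proof; the certificate itself and the `K = 7` consequence are in
`GoldbachLinnikDirectCertified.lean`.  No new mathematics.  This file is NOT a route to Goldbach and claims no value of `K`;
`K = 6` is NOT claimed.
-/
import Literature.NumberTheory.Sieve.GoldbachLinnikDirectExceptional

/-!
# Goldbach–Linnik by the direct route, V: a kernel-checkable certificate format for `m_K(D)`

Topic `Literature/NumberTheory/Sieve`.  Sequel to `GoldbachLinnikDirectMean.lean` (which reduced the singular-series mean of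
the direct route to the finite quantity `mKD K D = C₀ Σ_{1≤d≤D} k(d) · minResCount d K / ξ(d)^K` and left its VALUE as a
hypothesis).  **NOT A ROUTE TO GOLDBACH; no value of `K` is claimed here at all** — this file is bookkeeping that lets the
kernel evaluate `Σ_{d≤D} k(d) minResCount d K/ξ(d)^K` from a short certificate:

* the residue-class dynamic programme `rcVec d ξ K` (the distribution of `2^{e₁} + ⋯ + 2^{e_K} mod d`, `eᵢ ∈ [1, ξ]`, computed
  by `K` pointwise sums of `ξ` rotations, cost `O(K ξ d)`) and its correctness `rcVec_getD : rcVec d ξ(d) K [r] =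
  resCount d K r` (via the recursion `resCount_succ`);
* the certificate entry format `(d, prime factors ps, ξ, c)` with the boolean checker `certOK K D` — `1 ≤ d ≤ D`, `d = ∏ ps`,
  `ps` distinct primes `> 2` by trial division (`primeB`), `ξ = ord_d 2` by `2^ξ ≡ 1` and `2^m ≢ 1 (0 < m < ξ)` (`ord2Cert`),
  and `c ≤ min_r resCount d K r` by the dynamic programme (`rcCheck`) — its value `certVal K e = (∏_{p∈ps}(p−2)^{-1}) c/ξ^K`
  (`= k(d) c/ξ(d)^K`, `fq_one_list_prod`), and the soundness theorem
  **`certSum_le_sum`: `Σ_e certVal K e ≤ Σ_{1≤d≤D} k(d) minResCount d K / ξ(d)^K`** for a checked certificate with distinct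
  moduli (dropping moduli only decreases the certified value since every term is `≥ 0`).

All kernel evaluation happens in the sequel; everything here is a general (`K`, `D` arbitrary) soundness statement.

## References

* D. R. Heath-Brown, J.-C. Puchta, *Integers represented as a sum of primes and powers of two*, Asian J. Math. 6 (2002)
  535–565 (arXiv:math/0201299): §4 (21)–(22) (`k(d)`, `ξ(d)`, the truncated mean). [HeathbrownPuchta2002]
* D. J. Platt, T. S. Trudgian, *Linnik's approximation to Goldbach's conjecture, and other problems*, J. Number Theory 153
  (2015) 54–62: §2.1 (the same truncated mean evaluated numerically, comparator). [PlattTrudgian2015Linnik]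
-/

open Finset Filter

namespace Literature.NumberTheory.Sieve

namespace GoldbachLinnik

open SingularSeriesMean

/-! ### The residue-class dynamic programme and the certificate checker -/

/-- One convolution step, `(rcStep d ξ v)[r] = Σ_{e<ξ} v[(r − 2^{e+1}) mod d]`, computed as a pointwise sum of
`ξ` rotations of `v` (cost `O(ξ d)`). [folklore] -/
def rcStep (d ξ : ℕ) (v : List ℕ) : List ℕ :=
  (List.range ξ).foldr (fun e acc => List.zipWith (· + ·) (v.rotate (d - 2 ^ (e + 1) % d)) acc)
    (List.replicate d 0)

/-- `rcVec d ξ K`: the vector `r ↦ #{e ∈ [1,ξ]^K : Σ2^{eᵢ} ≡ r (mod d)}` computed by `K` convolution steps. [folklore] -/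
def rcVec (d ξ : ℕ) : ℕ → List ℕ
  | 0 => (List.range d).map fun r => if r = 0 then 1 else 0
  | K + 1 => rcStep d ξ (rcVec d ξ K)

/-- `rcCheck d ξ K c`: every entry of `rcVec d ξ K` is `≥ c`. [folklore] -/
def rcCheck (d ξ K c : ℕ) : Bool := (rcVec d ξ K).all fun x => decide (c ≤ x)

/-- Certificate that `ord_d 2 = ξ`: `d = ξ = 1`, or `d > 1`, `ξ > 0`, `2^ξ ≡ 1 (mod d)` and `2^m ≢ 1` for `0 < m < ξ`.
[folklore] -/
def ord2Cert (d ξ : ℕ) : Bool :=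
  (decide (d = 1) && decide (ξ = 1)) ||
    (decide (1 < d) && decide (0 < ξ) && decide (2 ^ ξ % d = 1) &&
      (List.range ξ).all fun m => decide (m = 0) || !decide (2 ^ m % d = 1))

/-- Primality by trial division (kernel-evaluable). [folklore] -/
def primeB (p : ℕ) : Bool := decide (2 ≤ p) && (List.range p).all fun m => decide (m < 2) || !decide (m ∣ p)

/-- `∏_{p ∈ ps} 1/(p − 2)` in `ℚ`. [folklore] -/
def invProdQ : List ℕ → ℚ
  | [] => 1
  | p :: ps => 1 / ((p : ℚ) - 2) * invProdQ ps

/-- `∏_{p ∈ ps} 1/(p − 2)` in `ℝ`. [folklore] -/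
noncomputable def invProdR : List ℕ → ℝ
  | [] => 1
  | p :: ps => 1 / ((p : ℝ) - 2) * invProdR ps

/-- A certificate entry `(d, ps, ξ, c)` claims: `d = ∏ ps` with `ps` distinct odd primes (so `k(d) = ∏_{p∈ps}(p−2)^{-1}`),
`ξ = ord_d 2`, and `min_r resCount d K r ≥ c`; its value is `k(d) · c / ξ^K`. [folklore] -/
def certVal (K : ℕ) (e : ℕ × List ℕ × ℕ × ℕ) : ℚ :=
  invProdQ e.2.1 * ((e.2.2.2 : ℚ) / (e.2.2.1 : ℚ) ^ K)

/-- The boolean checker of a certificate entry against `1 ≤ d ≤ D`. [folklore] -/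
def certOK (K D : ℕ) (e : ℕ × List ℕ × ℕ × ℕ) : Bool :=
  decide (1 ≤ e.1) && decide (e.1 ≤ D) && decide (e.2.1.prod = e.1) &&
    (e.2.1.all fun p => primeB p && decide (2 < p)) && decide e.2.1.Nodup &&
    ord2Cert e.1 e.2.2.1 && rcCheck e.1 e.2.2.1 K e.2.2.2

/-- The certified partial sum `Σ_e certVal K e`. [folklore] -/
def certSum (K : ℕ) : List (ℕ × List ℕ × ℕ × ℕ) → ℚ
  | [] => 0
  | e :: es => certVal K e + certSum K es

/-- Trial division is sound. [folklore] -/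
theorem prime_of_primeB {p : ℕ} (h : primeB p = true) : p.Prime := by
  simp only [primeB, Bool.and_eq_true, decide_eq_true_eq, List.all_eq_true, List.mem_range, Bool.or_eq_true,
    Bool.not_eq_true', decide_eq_false_iff_not] at h
  rw [Nat.prime_def_lt']
  refine ⟨h.1, fun m h2 hmp hdvd => ?_⟩
  rcases h.2 m hmp with h' | h'
  · omega
  · exact h' hdvd

/-- The order certificate is sound. [folklore] -/
theorem ord2_eq_of_cert {d ξ : ℕ} (h : ord2Cert d ξ = true) : ord2 d = ξ := by
  rw [ord2Cert, Bool.or_eq_true] at h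
  rcases h with h | h
  · simp only [Bool.and_eq_true, decide_eq_true_eq] at h
    obtain ⟨rfl, rfl⟩ := h
    rw [ord2, orderOf_eq_one_iff]
    decide
  · simp only [Bool.and_eq_true, decide_eq_true_eq, List.all_eq_true, List.mem_range, Bool.or_eq_true,
      Bool.not_eq_true', decide_eq_false_iff_not] at h
    obtain ⟨⟨⟨hd, hξ⟩, hpow⟩, hmin⟩ := h
    have key : ∀ m, (2 : ZMod d) ^ m = 1 ↔ 2 ^ m % d = 1 := by
      intro m
      rw [show (2 : ZMod d) ^ m = ((2 ^ m : ℕ) : ZMod d) by rw [Nat.cast_pow, Nat.cast_ofNat],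
        show (1 : ZMod d) = ((1 : ℕ) : ZMod d) by rw [Nat.cast_one], ZMod.natCast_eq_natCast_iff',
        Nat.one_mod_eq_one.2 hd.ne']
    rw [ord2, orderOf_eq_iff hξ]
    refine ⟨(key ξ).2 hpow, fun m hm hm0 habs => ?_⟩
    rcases hmin m hm with h0 | hne
    · omega
    · exact hne ((key m).1 habs)

/-- `k(∏ ps) = ∏_{p ∈ ps} 1/(p − 2)` for distinct odd primes `ps` (multiplicativity of `f₁` and `f₁(p) = 1/(p−2)`).
[cite: HeathbrownPuchta2002, §4 (21)] -/
theorem fq_one_list_prod : ∀ (ps : List ℕ), (∀ p ∈ ps, p.Prime ∧ 2 < p) → ps.Nodup →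
    fq 1 ps.prod = invProdR ps
  | [], _, _ => by simpa [invProdR] using (isMultiplicative_fq 1).map_one
  | p :: ps, hps, hnd => by
    have hp : p.Prime := (hps p (by simp)).1
    have hp2 : 2 < p := (hps p (by simp)).2
    have hps' : ∀ q ∈ ps, q.Prime ∧ 2 < q := fun q hq => hps q (by simp [hq])
    obtain ⟨hnot, hnd'⟩ := List.nodup_cons.1 hnd
    have hcop : Nat.Coprime p ps.prod := by
      rw [Nat.coprime_list_prod_right_iff]
      intro q hq
      exact (Nat.coprime_primes hp (hps' q hq).1).2 (fun h => hnot (h ▸ hq))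
    have hcop2 : Nat.Coprime p (2 * 1) := by
      rw [mul_one]
      exact (Nat.coprime_primes hp Nat.prime_two).2 (by omega)
    rw [List.prod_cons, (isMultiplicative_fq 1).map_mul_of_coprime hcop, fq_prime 1 hp, if_pos hcop2,
      fq_one_list_prod ps hps' hnd', invProdR]

/-- Cast of `invProdQ`. [folklore] -/
theorem cast_invProdQ : ∀ ps : List ℕ, ((invProdQ ps : ℚ) : ℝ) = invProdR ps
  | [] => by simp [invProdQ, invProdR]
  | p :: ps => by
    rw [invProdQ, invProdR, ← cast_invProdQ ps]
    push_cast
    ring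

/-- `invProdR ps ≥ 0` for entries `> 2`. [folklore] -/
theorem invProdR_nonneg : ∀ ps : List ℕ, (∀ p ∈ ps, 2 < p) → 0 ≤ invProdR ps
  | [], _ => by simp [invProdR]
  | p :: ps, h => by
    rw [invProdR]
    have hp : (2 : ℝ) < p := by exact_mod_cast h p (by simp)
    exact mul_nonneg (le_of_lt (one_div_pos.2 (by linarith)))
      (invProdR_nonneg ps fun q hq => h q (by simp [hq]))

/-- The fold `r ↦ Σ_e (g e)[r]` by pointwise additions: length and entries. [folklore] -/
theorem foldr_zipWith_spec {d : ℕ} (g : ℕ → List ℕ) (hg : ∀ e, (g e).length = d) :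
    ∀ es : List ℕ, (es.foldr (fun e acc => List.zipWith (· + ·) (g e) acc) (List.replicate d 0)).length = d ∧
      ∀ r < d, (es.foldr (fun e acc => List.zipWith (· + ·) (g e) acc) (List.replicate d 0))[r]? =
        some ((es.map fun e => (g e).getD r 0).sum)
  | [] => ⟨by simp, fun r hr => by simp [List.getElem?_replicate_of_lt hr]⟩
  | e :: es => by
    obtain ⟨hlen, hget⟩ := foldr_zipWith_spec g hg es
    refine ⟨by rw [List.foldr_cons, List.length_zipWith, hg, hlen, Nat.min_self], fun r hr => ?_⟩
    rw [List.foldr_cons, List.map_cons, List.sum_cons, List.getElem?_zipWith_eq_some]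
    refine ⟨(g e).getD r 0, (es.map fun e => (g e).getD r 0).sum, ?_, hget r hr, rfl⟩
    rw [List.getD_eq_getElem?_getD, List.getElem?_eq_getElem (by rw [hg]; exact hr), Option.getD_some]

/-- Entries of a rotation. [folklore] -/
theorem getD_rotate_of_length {v : List ℕ} {d : ℕ} (hv : v.length = d) (s : ℕ) {r : ℕ} (hr : r < d) :
    (v.rotate s).getD r 0 = v.getD ((r + s) % d) 0 := by
  rw [List.getD_eq_getElem?_getD, List.getD_eq_getElem?_getD, List.getElem?_rotate (by rw [hv]; exact hr), hv]

/-- Length of the DP vector. [folklore] -/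
theorem rcVec_length (d ξ : ℕ) : ∀ K, (rcVec d ξ K).length = d
  | 0 => by simp [rcVec]
  | K + 1 => by
    rw [rcVec, rcStep]
    exact (foldr_zipWith_spec _ (fun e => by rw [List.length_rotate, rcVec_length d ξ K]) _).1

/-- `((List.range n).map f).getD r x = f r` for `r < n`. [folklore] -/
theorem getD_map_range {α : Type*} (f : ℕ → α) {r n : ℕ} (hr : r < n) (x : α) :
    ((List.range n).map f).getD r x = f r := by
  rw [List.getD_eq_getElem?_getD, List.getElem?_map, List.getElem?_range hr, Option.map_some, Option.getD_some]

/-- List sum over `range` is the `Finset` sum. [folklore] -/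
theorem sum_map_range (g : ℕ → ℕ) (n : ℕ) : ((List.range n).map g).sum = ∑ e ∈ Finset.range n, g e := by
  induction n with
  | zero => simp
  | succ n ih => rw [List.range_succ, List.map_append, List.sum_append, ih, Finset.sum_range_succ]; simp

/-- The index arithmetic of `rcStep` in `ℤ/d`: `(r + (d − t mod d)) mod d = r − t`. [folklore] -/
theorem natCast_idx {d : ℕ} (hd : 0 < d) (r t : ℕ) :
    ((((r + (d - t % d)) % d : ℕ)) : ZMod d) = (r : ZMod d) - (t : ZMod d) := by
  have ht : t % d ≤ d := (Nat.mod_lt t hd).le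
  rw [ZMod.natCast_mod, Nat.cast_add, Nat.cast_sub ht, ZMod.natCast_self, ZMod.natCast_mod]
  ring

/-- `Σ_{ν ∈ [1,L]^{K+1}} f(ν) = Σ_{a ∈ [1,L]} Σ_{ν' ∈ [1,L]^K} f(a ∷ ν')` (any additive commutative monoid). [folklore] -/
theorem sum_expTuplesL_cons {M : Type*} [AddCommMonoid M] (L K : ℕ) (f : (Fin (K + 1) → ℕ) → M) :
    ∑ ν ∈ expTuplesL L (K + 1), f ν = ∑ a ∈ Icc 1 L, ∑ ν ∈ expTuplesL L K, f (Fin.cons a ν) := by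
  have h := Finset.filter_piFinset_eq_map_consEquiv (fun _ : Fin (K + 1) => Icc 1 L) (fun _ => True)
  rw [Finset.filter_true, Finset.filter_true] at h
  rw [expTuplesL, h, Finset.sum_map, Finset.sum_product]
  rfl

/-- `resCount d 0 r = [r = 0]`. [folklore] -/
theorem resCount_zero (d : ℕ) (r : ZMod d) : resCount d 0 r = if r = 0 then 1 else 0 := by
  obtain ⟨a, ha⟩ := Finset.card_eq_one.1 (by rw [card_expTuplesL, pow_zero] : (expTuplesL (ord2 d) 0).card = 1)
  rw [resCount, ha, Finset.filter_singleton]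
  have h0 : tupleSum a = 0 := by simp [tupleSum]
  simp only [h0, Nat.cast_zero]
  by_cases hr : r = 0
  · rw [if_pos hr.symm, if_pos hr, Finset.card_singleton]
  · rw [if_neg (fun h => hr h.symm), if_neg hr, Finset.card_empty]

/-- The convolution recursion: `resCount d (K+1) r = Σ_{e<ξ(d)} resCount d K (r − 2^{e+1})`. [folklore] -/
theorem resCount_succ (d K : ℕ) (r : ZMod d) :
    resCount d (K + 1) r = ∑ e ∈ Finset.range (ord2 d), resCount d K (r - 2 ^ (e + 1)) := by
  rw [resCount, Finset.card_filter, sum_expTuplesL_cons, ← Finset.Ico_add_one_right_eq_Icc,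
    Finset.sum_Ico_eq_sum_range, Nat.add_sub_cancel]
  refine Finset.sum_congr rfl fun e _ => ?_
  rw [resCount, Finset.card_filter]
  refine Finset.sum_congr rfl fun ν _ => ?_
  have key : ((tupleSum (Fin.cons (1 + e) ν : Fin (K + 1) → ℕ) : ℕ) : ZMod d) = r ↔
      ((tupleSum ν : ℕ) : ZMod d) = r - 2 ^ (e + 1) := by
    rw [tupleSum_cons, Nat.cast_add, Nat.cast_pow, Nat.cast_ofNat, add_comm 1 e]
    constructor
    · intro h; rw [← h]; ring
    · intro h; rw [h]; ring
  exact if_congr key rfl rfl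

/-- **Correctness of the dynamic programme**: `rcVec d ξ(d) K [r] = resCount d K r` for `r < d`. [folklore] -/
theorem rcVec_getD {d ξ : ℕ} (hd : 0 < d) (hξ : ord2 d = ξ) :
    ∀ K r, r < d → (rcVec d ξ K).getD r 0 = resCount d K (r : ZMod d) := by
  intro K
  induction K with
  | zero =>
    intro r hr
    rw [resCount_zero, rcVec, getD_map_range _ hr]
    have key : r = 0 ↔ (r : ZMod d) = 0 := by
      rw [ZMod.natCast_eq_zero_iff]
      constructor
      · rintro rfl; exact dvd_zero d
      · intro h; exact Nat.eq_zero_of_dvd_of_lt h hr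
    exact if_congr key rfl rfl
  | succ K ih =>
    intro r hr
    have hlenK := rcVec_length d ξ K
    have hspec := (foldr_zipWith_spec (d := d) (fun e => (rcVec d ξ K).rotate (d - 2 ^ (e + 1) % d))
      (fun e => by rw [List.length_rotate, hlenK]) (List.range ξ)).2 r hr
    beta_reduce at hspec
    rw [resCount_succ, hξ, rcVec, rcStep, List.getD_eq_getElem?_getD, hspec, Option.getD_some, sum_map_range]
    refine Finset.sum_congr rfl fun e _ => ?_
    rw [getD_rotate_of_length hlenK _ hr, ih _ (Nat.mod_lt _ hd), natCast_idx hd, Nat.cast_pow, Nat.cast_ofNat]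

/-- Soundness of `rcCheck`: `c ≤ minResCount d K`. [folklore] -/
theorem le_minResCount_of_rcCheck {d ξ K c : ℕ} (hd : 0 < d) (hξ : ord2 d = ξ) (h : rcCheck d ξ K c = true) :
    c ≤ minResCount d K := by
  rw [minResCount, dif_neg hd.ne', Finset.le_inf'_iff]
  intro r hr
  rw [Finset.mem_range] at hr
  rw [← rcVec_getD hd hξ K r hr]
  rw [rcCheck, List.all_eq_true] at h
  have hlen : r < (rcVec d ξ K).length := by rw [rcVec_length]; exact hr
  have hmem : (rcVec d ξ K).getD r 0 ∈ rcVec d ξ K := by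
    rw [List.getD_eq_getElem?_getD, List.getElem?_eq_getElem hlen, Option.getD_some]
    exact List.getElem_mem hlen
  exact of_decide_eq_true (h _ hmem)

/-- Soundness of one certificate entry: its value is below the corresponding term of `m_K(D)/C₀`.
[cite: HeathbrownPuchta2002, §4 (22)] -/
theorem certVal_le_term {K D : ℕ} {e : ℕ × List ℕ × ℕ × ℕ} (h : certOK K D e = true) :
    ((certVal K e : ℚ) : ℝ) ≤ fq 1 e.1 * ((minResCount e.1 K : ℝ) / (ord2 e.1 : ℝ) ^ K) := by
  obtain ⟨d, ps, ξ, c⟩ := e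
  simp only [certOK, Bool.and_eq_true, decide_eq_true_eq, List.all_eq_true] at h
  obtain ⟨⟨⟨⟨⟨⟨hd1, -⟩, hprod⟩, hps⟩, hnd⟩, hord⟩, hrc⟩ := h
  have hps' : ∀ p ∈ ps, p.Prime ∧ 2 < p := fun p hp => ⟨prime_of_primeB (hps p hp).1, (hps p hp).2⟩
  have hξ : ord2 d = ξ := ord2_eq_of_cert hord
  have hc : c ≤ minResCount d K := le_minResCount_of_rcCheck hd1 hξ hrc
  have hfq : fq 1 d = invProdR ps := by rw [← hprod]; exact fq_one_list_prod ps hps' hnd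
  have hval : ((certVal K (d, ps, ξ, c) : ℚ) : ℝ) = invProdR ps * ((c : ℝ) / (ξ : ℝ) ^ K) := by
    rw [certVal, ← cast_invProdQ]
    push_cast
    rfl
  rw [hval]
  show invProdR ps * ((c : ℝ) / (ξ : ℝ) ^ K) ≤ fq 1 d * ((minResCount d K : ℝ) / (ord2 d : ℝ) ^ K)
  rw [hfq, hξ]
  refine mul_le_mul_of_nonneg_left ?_ (invProdR_nonneg ps fun p hp => (hps' p hp).2)
  exact div_le_div_of_nonneg_right (by exact_mod_cast hc) (by positivity)

/-- **Soundness of a certificate**: if every entry checks against `D` and the moduli are distinct, the certified sum is below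
`Σ_{1≤d≤D} k(d) minResCount d K/ξ(d)^K = m_K(D)/C₀`. [cite: HeathbrownPuchta2002, §4 (22)] -/
theorem certSum_le_sum (K D : ℕ) : ∀ cert : List (ℕ × List ℕ × ℕ × ℕ), cert.all (certOK K D) = true →
    (cert.map Prod.fst).Nodup →
    ((certSum K cert : ℚ) : ℝ) ≤ ∑ d ∈ Icc 1 D, fq 1 d * ((minResCount d K : ℝ) / (ord2 d : ℝ) ^ K) := by
  -- first over the finset of certified moduli
  have main : ∀ cert : List (ℕ × List ℕ × ℕ × ℕ), cert.all (certOK K D) = true → (cert.map Prod.fst).Nodup →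
      (∀ d ∈ (cert.map Prod.fst).toFinset, d ∈ Icc 1 D) ∧
      ((certSum K cert : ℚ) : ℝ) ≤
        ∑ d ∈ (cert.map Prod.fst).toFinset, fq 1 d * ((minResCount d K : ℝ) / (ord2 d : ℝ) ^ K) := by
    intro cert
    induction cert with
    | nil => intro _ _; simp [certSum]
    | cons e es ih =>
      intro hall hnd
      rw [List.all_cons, Bool.and_eq_true] at hall
      rw [List.map_cons, List.nodup_cons] at hnd
      obtain ⟨hD, hle⟩ := ih hall.2 hnd.2
      have he := hall.1
      have hbounds : 1 ≤ e.1 ∧ e.1 ≤ D := by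
        simp only [certOK, Bool.and_eq_true, decide_eq_true_eq] at he
        exact ⟨he.1.1.1.1.1.1, he.1.1.1.1.1.2⟩
      have hnotin : e.1 ∉ (es.map Prod.fst).toFinset := fun h => hnd.1 (List.mem_toFinset.1 h)
      refine ⟨?_, ?_⟩
      · intro d hd
        rw [List.map_cons, List.toFinset_cons, Finset.mem_insert] at hd
        rcases hd with rfl | hd
        · exact Finset.mem_Icc.2 hbounds
        · exact hD d hd
      · rw [List.map_cons, List.toFinset_cons, Finset.sum_insert hnotin, certSum, Rat.cast_add]
        exact add_le_add (certVal_le_term he) hle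
  intro cert hall hnd
  obtain ⟨hD, hle⟩ := main cert hall hnd
  exact hle.trans (Finset.sum_le_sum_of_subset_of_nonneg hD fun d _ _ => mul_nonneg (fq_nonneg 1 d) (by positivity))

end GoldbachLinnik

end Literature.NumberTheory.Sieve
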